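import Mathlib.NumberTheory.Harmonic.Bounds
import Summits.QuantumFields.BalabanUV.Beta.EriceRemainderEnclosureHistoryAutonomyFunctionalShift
import Summits.QuantumFields.BalabanUV.Beta.EriceRemainderEnclosureHistoryAutonomyFunctionalShiftWitness

/-!
# EriceRemainderEnclosureHistoryAutonomyFunctionalShiftRates — (E51e) THE GROWTH TABLE OF THE LEVEL SHIFT BY REMAINDER PROFILE: for ANY pair in (E51a)'s
# regime (`B` zeroth moment `M`, floor `b`, `M·γ ≤ (3√3∕2)·b`, `M·γ³ ≤ 1∕2`; `B′` floor `b`, sub-box excess `≤ ρ(a)`; one pin) an (AF-1)-TYPE remainder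
# `ρ(a) = C·a` moves the levels by at most `2e^{6M∕(b√b)}·(2C∕√b)·√m`, a TWO-LOOP-TYPE remainder `ρ(a) = C·a²` by at most `2e^{6M∕(b√b)}·(C∕b)·(1 + log m)`
# — and the Markov witnesses of (E51c) attain these orders: `≥ (C∕√(1∕p² + b + Cγ))·√m` resp. `≥ (C∕(1∕p² + b + Cγ²))·log(m+1)`.  With (E51b)∕(E51c)
# (`s = 0`: `Θ(m·r)`; `s > 2`: `O(1)`) the table is complete: exponent `0 ↦ Θ(m)`, `1 ↦ Θ(√m)`, `2 ↦ Θ(log m)`, `> 2 ↦ O(1)` — the discrete shadows of a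
# changed one-loop coefficient, of a `√`-law, of the `log log μ` two-loop term, and of a finite Λ-shift

Cell `pub-balaban`, β-function sub-cell, BINDER row D4 «RemainderConst leaves for Bałaban's split» (`HOME/BINDER-OWNERS.md`; owner lineage `b2b-balaban-beta-an4`;
this file by co-owner #2 lineage `b2b-balaban-beta-d4-p2`, generation 47), β-FLOW TEAM duty (1), FREEZE (0) honoured (def-free; (E51a)'s
`abs_disc_le_two_exp_mul_sum`, (E51c)'s `sum_profile_le_disc`, node U2's `T4OneLoopAsymptotics.sum_inv_sqrt_succ_le` ∕ `T4TwoLoopLaw.abs_sum_inv_succ_sub_log_le`,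
Mathlib's `log_add_one_le_harmonic` BY NAME).  Sequel of (E51a) `…FunctionalShift` and (E51c) `…FunctionalShiftWitness`; companion (E51b) `…FunctionalShiftLimit`.

HONEST FRAMING (page 1, verbatim and binding).  *"Discharging BetaPertH makes Bałaban's UV stability UNCONDITIONAL — a real constructive-QFT result; it is
NOT the continuum limit and NOT the Clay problem."*  THIS FILE DISCHARGES NOTHING OF THE KIND.  Elementary sums (`Σ 1∕i` against `log`, `Σ 1∕√i` against
`√`) composed with (E51a)∕(E51c); two ABSTRACT functionals and explicit Markov examples; nothing of Bałaban's (1.22) asserted — which profile its remainder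
has is row D4's OPEN discharge (`RemainderConst`) or NOT PRINTED.  «two-loop-type» ∕ «(AF-1)-type» name the PROFILES `C·a²` ∕ `C·a` of an abstract excess,
not an identification of Bałaban's coefficients.  Row D4 class UNCHANGED (critical-path width 0; instance 0∕1; D4 DISCHARGE NO DATE).  HONEST DEPENDENCY:
continuum YM on T⁴ ⇐ BetaPertH ∧ nine spine estimates (0/9 proved); BetaPertH ⇐ (D1) ∧ (D4) ∧ CAP+tail; G-an2-4 gates asym, D1 and NE2/3/4.

THE POINT (census sense (α)).  (E51a) reduces the level shift to the envelope sum `Σ_{i≤m} ρ(c_i)`, `c_i ≤ (i·b)^{−1∕2}`; (E51c) shows the Markov pair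
realises `Σ_{i≤m} ρ(h′_i)` with `h′_i ≥ (1∕p² + i·U)^{−1∕2}`.  So the growth of the shift in the scale is that of `Σ_{i≤m} ρ(i^{−1∕2})` on both sides:
`ρ(a) = C·a` ⟹ `Σ C∕√i ≍ √m` (§1 `sum_envelope_le` ∕ `sqrt_mul_le_sum_inv_sqrt`), `ρ(a) = C·a²` ⟹ `Σ C∕i ≍ log m` (§1 `sum_sq_envelope_le` ∕
`log_mul_le_sum_inv`).  For CITATION-FIT this prices each remainder leaf by what it leaves undetermined in the continuum running coupling's levels
`1∕(g⋆_m)²`: `RemainderConst` `±Θ(m·r)`, (AF-1) `±Θ(√m)`, a two-loop-sized bound `±Θ(log m)`, a three-loop-sized bound `±O(1)`.  NOT claimed: sharp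
constants; lower bounds with memory (`M > 0`); anything about Bałaban's remainder.

WHAT IS PROVED ([folklore]; 0 `def`, 0 sorry).  §1 `sum_inv_succ_le_one_add_log`, `log_succ_le_sum_inv_succ`, **`sum_sq_envelope_le`** (`≤ (C∕b)(1 + log m)`),
**`sum_envelope_le`** (`≤ (2C∕√b)√m`), `log_mul_le_sum_inv`, `sqrt_mul_le_sum_inv_sqrt`.  §2 **`abs_disc_le_sqrt`** ((AF-1)-type: `O(√m)`), **`abs_disc_le_log`**
(two-loop-type: `O(log m)`).  §3 **`sqrt_le_disc_af1`** (Markov witness `≥ (C∕√(1∕p²+b+Cγ))√m`), **`log_le_disc_two_loop`** (`≥ (C∕(1∕p²+b+Cγ²)) log(m+1)`).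
-/

noncomputable section
open Filter Topology Finset

namespace Summit.QuantumFields.BalabanUV.Beta.EriceRemainderEnclosureHistoryAutonomyFunctionalShiftRates

open Literature.MathematicalPhysics.QuantumFieldTheory.Balaban1983to89
open Literature.MathematicalPhysics.QuantumFieldTheory.Balaban1983to89.T4BetaStationary
open Literature.MathematicalPhysics.QuantumFieldTheory.Balaban1983to89.T4BetaFlowWellPosed
open Literature.MathematicalPhysics.QuantumFieldTheory.Balaban1983to89.T4OneLoopAsymptotics (sum_inv_sqrt_succ_le)
open Literature.MathematicalPhysics.QuantumFieldTheory.Balaban1983to89.T4TwoLoopLaw (abs_sum_inv_succ_sub_log_le)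
open Summit.QuantumFields.BalabanUV.Beta.EriceRemainderEnclosureHistoryAutonomyFunctionalShift
open Summit.QuantumFields.BalabanUV.Beta.EriceRemainderEnclosureHistoryAutonomyFunctionalShiftWitness

variable {B B' : (ℕ → ℝ) → ℝ} {M γ b p : ℝ} {h h' : ℕ → ℝ}

/-! ## §1 Envelope sums: `Σ c_i² = O(log m)`, `Σ c_i = O(√m)`, and the matching lower sums -/

/-- THE HARMONIC SUM AGAINST THE LOGARITHM, upper side: `Σ_{i<m} 1∕(i+1) ≤ 1 + log m` (`m ≥ 1`). [folklore] -/
theorem sum_inv_succ_le_one_add_log {m : ℕ} (hm : 1 ≤ m) : ∑ i ∈ range m, 1 / ((i : ℝ) + 1) ≤ 1 + Real.log m := by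
  have := (abs_le.1 (abs_sum_inv_succ_sub_log_le hm)).2
  linarith

/-- … lower side: `log (m+1) ≤ Σ_{i<m} 1∕(i+1)` (Mathlib `log_add_one_le_harmonic`). [folklore] -/
theorem log_succ_le_sum_inv_succ (m : ℕ) : Real.log ((m : ℝ) + 1) ≤ ∑ i ∈ range m, 1 / ((i : ℝ) + 1) := by
  have hlow := log_add_one_le_harmonic m
  have hcast : ((harmonic m : ℚ) : ℝ) = ∑ i ∈ range m, 1 / ((i : ℝ) + 1) := by
    push_cast [harmonic]
    exact sum_congr rfl fun i _ => by rw [one_div]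
  rw [hcast] at hlow
  push_cast at hlow
  exact hlow

/-- **THE SQUARED ENVELOPE SUMS LIKE `log`**: `Σ_{i<m} C·c_{i+1}² ≤ (C∕b)·(1 + log m)` for `m ≥ 1` (`c_{i+1}² ≤ 1∕((i+1)b)`). [folklore] -/
theorem sum_sq_envelope_le {C : ℝ} (hb : 0 < b) (hC : 0 ≤ C) (p : ℝ) {m : ℕ} (hm : 1 ≤ m) :
    ∑ i ∈ range m, C * (1 / Real.sqrt (1 / p ^ 2 + ((i : ℝ) + 1) * b)) ^ 2 ≤ C / b * (1 + Real.log m) := by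
  have hterm : ∀ i : ℕ, C * (1 / Real.sqrt (1 / p ^ 2 + ((i : ℝ) + 1) * b)) ^ 2 ≤ C / b * (1 / ((i : ℝ) + 1)) := by
    intro i
    have hP : 0 < 1 / p ^ 2 + ((i : ℝ) + 1) * b := by positivity
    rw [div_pow, one_pow, Real.sq_sqrt hP.le]
    have h1 : 1 / (1 / p ^ 2 + ((i : ℝ) + 1) * b) ≤ 1 / (((i : ℝ) + 1) * b) :=
      one_div_le_one_div_of_le (by positivity) (le_add_of_nonneg_left (by positivity))
    calc C * (1 / (1 / p ^ 2 + ((i : ℝ) + 1) * b)) ≤ C * (1 / (((i : ℝ) + 1) * b)) := mul_le_mul_of_nonneg_left h1 hC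
      _ = C / b * (1 / ((i : ℝ) + 1)) := by field_simp
  calc ∑ i ∈ range m, C * (1 / Real.sqrt (1 / p ^ 2 + ((i : ℝ) + 1) * b)) ^ 2
      ≤ ∑ i ∈ range m, C / b * (1 / ((i : ℝ) + 1)) := sum_le_sum fun i _ => hterm i
    _ = C / b * ∑ i ∈ range m, 1 / ((i : ℝ) + 1) := by rw [mul_sum]
    _ ≤ C / b * (1 + Real.log m) := mul_le_mul_of_nonneg_left (sum_inv_succ_le_one_add_log hm) (div_nonneg hC hb.le)

/-- **THE ENVELOPE SUMS LIKE `√m`**: `Σ_{i<m} C·c_{i+1} ≤ (2C∕√b)·√m` (`c_{i+1} ≤ 1∕√((i+1)b)`, node U2's `sum_inv_sqrt_succ_le`). [folklore] -/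
theorem sum_envelope_le {C : ℝ} (hb : 0 < b) (hC : 0 ≤ C) (p : ℝ) (m : ℕ) :
    ∑ i ∈ range m, C * (1 / Real.sqrt (1 / p ^ 2 + ((i : ℝ) + 1) * b)) ≤ 2 * C / Real.sqrt b * Real.sqrt (m : ℝ) := by
  have hsb : 0 < Real.sqrt b := Real.sqrt_pos.2 hb
  have hterm : ∀ i : ℕ, C * (1 / Real.sqrt (1 / p ^ 2 + ((i : ℝ) + 1) * b)) ≤ C / Real.sqrt b * (1 / Real.sqrt ((i : ℝ) + 1)) := by
    intro i
    have hy : 0 < ((i : ℝ) + 1) * b := by positivity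
    have h1 : 1 / Real.sqrt (1 / p ^ 2 + ((i : ℝ) + 1) * b) ≤ 1 / Real.sqrt (((i : ℝ) + 1) * b) :=
      one_div_sqrt_anti hy (le_add_of_nonneg_left (by positivity))
    rw [Real.sqrt_mul' _ hb.le] at h1
    calc C * (1 / Real.sqrt (1 / p ^ 2 + ((i : ℝ) + 1) * b)) ≤ C * (1 / (Real.sqrt ((i : ℝ) + 1) * Real.sqrt b)) :=
          mul_le_mul_of_nonneg_left h1 hC
      _ = C / Real.sqrt b * (1 / Real.sqrt ((i : ℝ) + 1)) := by field_simp
  calc ∑ i ∈ range m, C * (1 / Real.sqrt (1 / p ^ 2 + ((i : ℝ) + 1) * b))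
      ≤ ∑ i ∈ range m, C / Real.sqrt b * (1 / Real.sqrt ((i : ℝ) + 1)) := sum_le_sum fun i _ => hterm i
    _ = C / Real.sqrt b * ∑ i ∈ range m, 1 / Real.sqrt ((i : ℝ) + 1) := by rw [mul_sum]
    _ ≤ C / Real.sqrt b * (2 * Real.sqrt (m : ℝ)) := mul_le_mul_of_nonneg_left (sum_inv_sqrt_succ_le m) (by positivity)
    _ = 2 * C / Real.sqrt b * Real.sqrt (m : ℝ) := by ring

/-- THE LOWER SQUARED SUM: `Σ_{i<m} C∕(A + (i+1)U) ≥ (C∕(A+U))·log(m+1)` (`A ≥ 0`, `U > 0`, `C ≥ 0`: `A + (i+1)U ≤ (i+1)(A+U)`). [folklore] -/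
theorem log_mul_le_sum_inv {A U C : ℝ} (hA : 0 ≤ A) (hU : 0 < U) (hC : 0 ≤ C) (m : ℕ) :
    C / (A + U) * Real.log ((m : ℝ) + 1) ≤ ∑ i ∈ range m, C * (1 / (A + ((i : ℝ) + 1) * U)) := by
  have hterm : ∀ i : ℕ, C / (A + U) * (1 / ((i : ℝ) + 1)) ≤ C * (1 / (A + ((i : ℝ) + 1) * U)) := by
    intro i
    have h1 : 1 / ((A + U) * ((i : ℝ) + 1)) ≤ 1 / (A + ((i : ℝ) + 1) * U) :=
      one_div_le_one_div_of_le (by positivity) (by nlinarith [(Nat.cast_nonneg i : (0 : ℝ) ≤ i)])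
    calc C / (A + U) * (1 / ((i : ℝ) + 1)) = C * (1 / ((A + U) * ((i : ℝ) + 1))) := by field_simp
      _ ≤ C * (1 / (A + ((i : ℝ) + 1) * U)) := mul_le_mul_of_nonneg_left h1 hC
  calc C / (A + U) * Real.log ((m : ℝ) + 1) ≤ C / (A + U) * ∑ i ∈ range m, 1 / ((i : ℝ) + 1) :=
        mul_le_mul_of_nonneg_left (log_succ_le_sum_inv_succ m) (by positivity)
    _ = ∑ i ∈ range m, C / (A + U) * (1 / ((i : ℝ) + 1)) := by rw [mul_sum]
    _ ≤ ∑ i ∈ range m, C * (1 / (A + ((i : ℝ) + 1) * U)) := sum_le_sum fun i _ => hterm i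

/-- THE LOWER LINEAR SUM: `Σ_{i<m} C∕√(A + (i+1)U) ≥ (C∕√(A+U))·√m` (`A + (i+1)U ≤ m(A+U)` for `i < m`). [folklore] -/
theorem sqrt_mul_le_sum_inv_sqrt {A U C : ℝ} (hA : 0 ≤ A) (hU : 0 < U) (hC : 0 ≤ C) (m : ℕ) :
    C / Real.sqrt (A + U) * Real.sqrt (m : ℝ) ≤ ∑ i ∈ range m, C * (1 / Real.sqrt (A + ((i : ℝ) + 1) * U)) := by
  rcases Nat.eq_zero_or_pos m with rfl | hm
  · simp
  have hm' : (1 : ℝ) ≤ m := by exact_mod_cast hm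
  have hAU : 0 < A + U := by positivity
  have hterm : ∀ i ∈ range m, C * (1 / Real.sqrt ((m : ℝ) * (A + U))) ≤ C * (1 / Real.sqrt (A + ((i : ℝ) + 1) * U)) := by
    intro i hi
    have him : (i : ℝ) + 1 ≤ m := by exact_mod_cast Nat.succ_le_of_lt (mem_range.1 hi)
    refine mul_le_mul_of_nonneg_left (one_div_sqrt_anti (by positivity) ?_) hC
    nlinarith [(Nat.cast_nonneg i : (0 : ℝ) ≤ i)]
  have hsum := sum_le_sum hterm
  rw [sum_const, card_range, nsmul_eq_mul] at hsum
  refine le_trans (le_of_eq ?_) hsum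
  have hsm : 0 < Real.sqrt (m : ℝ) := Real.sqrt_pos.2 (by linarith)
  have hm2 : Real.sqrt (m : ℝ) ^ 2 = m := Real.sq_sqrt (by linarith)
  rw [Real.sqrt_mul' _ hAU.le]
  field_simp
  nlinarith [hm2]

/-! ## §2 Upper growth rates for ANY pair in the regime: `O(√m)` for an (AF-1)-type, `O(log m)` for a two-loop-type remainder -/

/-- **AN (AF-1)-TYPE REMAINDER MOVES THE LEVELS BY AT MOST `O(√m)`**: `|B − B′| ≤ C·a` on each sub-box ]0,a]^ℕ ⟹
`|1∕h_m² − 1∕h′_m²| ≤ 2e^{6M∕(b√b)}·(2C∕√b)·√m`. [folklore] -/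
theorem abs_disc_le_sqrt {C : ℝ}
    (hB : ∀ u u' : ℕ → ℝ, SeqBox γ u → SeqBox γ u' → ∀ D : ℝ, (∀ j, |u j - u' j| ≤ D) → |B u - B u'| ≤ M * D)
    (hM : 0 ≤ M) (hp : 0 < p) (hpγ : p ≤ γ) (hb : 0 < b)
    (hlo : ∀ u, SeqBox γ u → b ≤ B u) (hlo' : ∀ u, SeqBox γ u → b ≤ B' u) (hq : M * γ ≤ 3 * Real.sqrt 3 * b / 2)
    (hK : M * γ ^ 3 ≤ 1 / 2) (hC : 0 ≤ C) (hρ : ∀ a : ℝ, 0 < a → a ≤ γ → ∀ u, SeqBox a u → |B u - B' u| ≤ C * a)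
    (hh : SeqBox γ h) (hh' : SeqBox γ h') (hf : MemFlow B p h) (hf' : MemFlow B' p h') (m : ℕ) :
    |1 / h m ^ 2 - 1 / h' m ^ 2| ≤ 2 * Real.exp (6 * M / (b * Real.sqrt b)) * (2 * C / Real.sqrt b * Real.sqrt (m : ℝ)) :=
  (abs_disc_le_two_exp_mul_sum (ρ := fun a => C * a) hB hM hp hpγ hb hlo hlo' hq hK hρ hh hh' hf hf' m).trans
    (mul_le_mul_of_nonneg_left (sum_envelope_le hb hC p m) (by positivity))

/-- **A TWO-LOOP-TYPE REMAINDER MOVES THE LEVELS BY AT MOST `O(log m)`**: `|B − B′| ≤ C·a²` on each sub-box ]0,a]^ℕ ⟹ for `m ≥ 1`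
`|1∕h_m² − 1∕h′_m²| ≤ 2e^{6M∕(b√b)}·(C∕b)·(1 + log m)` — the discrete shadow of the `log log` term of the running coupling. [folklore] -/
theorem abs_disc_le_log {C : ℝ}
    (hB : ∀ u u' : ℕ → ℝ, SeqBox γ u → SeqBox γ u' → ∀ D : ℝ, (∀ j, |u j - u' j| ≤ D) → |B u - B u'| ≤ M * D)
    (hM : 0 ≤ M) (hp : 0 < p) (hpγ : p ≤ γ) (hb : 0 < b)
    (hlo : ∀ u, SeqBox γ u → b ≤ B u) (hlo' : ∀ u, SeqBox γ u → b ≤ B' u) (hq : M * γ ≤ 3 * Real.sqrt 3 * b / 2)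
    (hK : M * γ ^ 3 ≤ 1 / 2) (hC : 0 ≤ C) (hρ : ∀ a : ℝ, 0 < a → a ≤ γ → ∀ u, SeqBox a u → |B u - B' u| ≤ C * a ^ 2)
    (hh : SeqBox γ h) (hh' : SeqBox γ h') (hf : MemFlow B p h) (hf' : MemFlow B' p h') {m : ℕ} (hm : 1 ≤ m) :
    |1 / h m ^ 2 - 1 / h' m ^ 2| ≤ 2 * Real.exp (6 * M / (b * Real.sqrt b)) * (C / b * (1 + Real.log m)) :=
  (abs_disc_le_two_exp_mul_sum (ρ := fun a => C * a ^ 2) hB hM hp hpγ hb hlo hlo' hq hK hρ hh hh' hf hf' m).trans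
    (mul_le_mul_of_nonneg_left (sum_sq_envelope_le hb hC p hm) (by positivity))

/-! ## §3 Matching lower rates for the Markov witnesses: `Θ(√m)` and `Θ(log m)` -/

variable {ρ : ℝ → ℝ}

/-- **THE (AF-1)-TYPE MARKOV WITNESS GROWS LIKE `√m`**: for `B ≡ b`, `B′(u) = b + C·u₀` and ANY box solution `h′` of `B′` from `p ∈ ]0,γ]`,
`1∕h′_m² − (1∕p² + m·b) ≥ (C∕√(1∕p² + b + C·γ))·√m`. [folklore] -/
theorem sqrt_le_disc_af1 {C : ℝ} (hp : 0 < p) (hpγ : p ≤ γ) (hb : 0 < b) (hC : 0 ≤ C) (hh' : SeqBox γ h')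
    (hf' : MemFlow (fun u : ℕ → ℝ => b + C * u 0) p h') (m : ℕ) :
    C / Real.sqrt (1 / p ^ 2 + (b + C * γ)) * Real.sqrt (m : ℝ) ≤ 1 / h' m ^ 2 - (1 / p ^ 2 + (m : ℝ) * b) := by
  have hγ : 0 < γ := hp.trans_le hpγ
  have hρ0 : ∀ a, 0 < a → a ≤ γ → 0 ≤ (fun a : ℝ => C * a) a := fun a ha _ => mul_nonneg hC ha.le
  have hρm : ∀ a a', 0 < a → a ≤ a' → a' ≤ γ → (fun a : ℝ => C * a) a ≤ (fun a : ℝ => C * a) a' :=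
    fun a a' _ haa' _ => mul_le_mul_of_nonneg_left haa' hC
  have h1 := sum_profile_le_disc (ρ := fun a : ℝ => C * a) hp hpγ hb hρ0 hρm hh' hf' m
  refine le_trans ?_ h1
  exact sqrt_mul_le_sum_inv_sqrt (by positivity) (by positivity : 0 < b + C * γ) hC m

/-- **THE TWO-LOOP-TYPE MARKOV WITNESS GROWS LIKE `log m`**: for `B ≡ b`, `B′(u) = b + C·u₀²` and ANY box solution `h′` of `B′` from `p ∈ ]0,γ]`,
`1∕h′_m² − (1∕p² + m·b) ≥ (C∕(1∕p² + b + C·γ²))·log(m+1)`. [folklore] -/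
theorem log_le_disc_two_loop {C : ℝ} (hp : 0 < p) (hpγ : p ≤ γ) (hb : 0 < b) (hC : 0 ≤ C) (hh' : SeqBox γ h')
    (hf' : MemFlow (fun u : ℕ → ℝ => b + C * (u 0) ^ 2) p h') (m : ℕ) :
    C / (1 / p ^ 2 + (b + C * γ ^ 2)) * Real.log ((m : ℝ) + 1) ≤ 1 / h' m ^ 2 - (1 / p ^ 2 + (m : ℝ) * b) := by
  have hγ : 0 < γ := hp.trans_le hpγ
  have hρ0 : ∀ a, 0 < a → a ≤ γ → 0 ≤ (fun a : ℝ => C * a ^ 2) a := fun a _ _ => by positivity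
  have hρm : ∀ a a', 0 < a → a ≤ a' → a' ≤ γ → (fun a : ℝ => C * a ^ 2) a ≤ (fun a : ℝ => C * a ^ 2) a' :=
    fun a a' ha haa' _ => mul_le_mul_of_nonneg_left (pow_le_pow_left₀ ha.le haa' 2) hC
  have h1 := sum_profile_le_disc (ρ := fun a : ℝ => C * a ^ 2) hp hpγ hb hρ0 hρm hh' hf' m
  refine le_trans ?_ h1
  have hU : 0 < b + C * γ ^ 2 := by positivity
  have e : ∀ i : ℕ, (fun a : ℝ => C * a ^ 2) (1 / Real.sqrt (1 / p ^ 2 + ((i : ℝ) + 1) * (b + C * γ ^ 2)))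
      = C * (1 / (1 / p ^ 2 + ((i : ℝ) + 1) * (b + C * γ ^ 2))) := fun i => by
    have hP : 0 < 1 / p ^ 2 + ((i : ℝ) + 1) * (b + C * γ ^ 2) := by positivity
    simp only [div_pow, one_pow, Real.sq_sqrt hP.le]
  rw [sum_congr rfl fun i _ => e i]
  exact log_mul_le_sum_inv (by positivity) hU hC m

end Summit.QuantumFields.BalabanUV.Beta.EriceRemainderEnclosureHistoryAutonomyFunctionalShiftRates

end
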